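import Summits.Ventures.CertifiedManyBodySolver.Observables.SourcedGibbsTrialCap
import HarnessLib

/-!
# DRESSED Gibbs trial states: the variational cap `E₀(A) ≤ Re⟨K A K⟩_β / Re⟨K K⟩_β` (§1, generic, finite-dimensional)

HONEST FRAMING: zero compute; a generic finite-dimensional inequality (Rayleigh–Ritz for the density matrix
`σ = K ρ_β K / tr(ρ_β K²)`); nothing model-specific, no number, no order, no phase sentence.

This is the first file of the «dressed HF–BCS cap» leg of the pinning-field response menu (cell `hubbard-obs`, seat
`hubbard-obs-pin-2`, row «Hellmann–Feynman brackets from certified e₀(h ± δh)»): the certified HF–BCS cap of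
`SourcedGibbsTrialCapHFBCS` / `…KSpace` takes `K = 1`; a DRESSING `K = 1 + λ·W` by a Hermitian correlator `W` (linearised
Gutzwiller `W = Σ_x n_{x↑}n_{x↓} − ⟨·⟩`, or a nearest-neighbour density / spin Jastrow factor) keeps every term a thermal
expectation of a polynomial in the fields in the QUASI-FREE state `ρ_β`, hence a Gaudin/Wick Pfaffian of two-point
functions — certifiable exactly as the HF–BCS cap, and strictly variational by §1. The gain is the part of the correlation
energy (`≈ c·U²` per site) that the one-body trial misses; the MENU sizing (HOME `hfbcs-cap/menu/MENU.md` §2) shows this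
slack, not the field gain, is what bounds the reach of the HF bracket in `h`.

Contents (§1): `re_gibbsState_conj_sub_groundEnergy_nonneg` (`0 ≤ Re⟨K(A − E₀)K⟩`), `groundEnergy_mul_re_gibbsState_le`
(`E₀·Re⟨KK⟩ ≤ Re⟨KAK⟩`), `groundEnergy_le_re_gibbsState_dressed` (quotient form under `0 < Re⟨KK⟩`),
`re_gibbsState_mul_self_nonneg` (`0 ≤ Re⟨WW⟩` for Hermitian `W`), `one_le_re_gibbsState_one_add_sq` (centred dressing:
`Re⟨W⟩ = 0 ⇒ 1 ≤ Re⟨(1+W)(1+W)⟩`), `groundEnergy_le_re_gibbsState_dressed_centred` (hypothesis-free quotient for centred `W`),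
and the polynomial bookkeeping `conj_one_add_smul_expand` / `gibbsState_dressed_num` / `gibbsState_dressed_den`
(`⟨(1+λW)A(1+λW)⟩ = ⟨A⟩ + λ(⟨WA⟩ + ⟨AW⟩) + λ²⟨WAW⟩`, `⟨(1+λW)(1+λW)⟩ = 1 + 2λ⟨W⟩ + λ²⟨WW⟩`) with the assembled
`groundEnergy_le_dressed_ratio` — the shape a certificate discharges with five certified reals and one rational `λ`.
No definition, no named fact, no `sorry`.

References: H. Tasaki, *Physics and Mathematics of Quantum Many-Body Systems* (2020) §2.1, App. A (variational principle,
Gibbs states) [Tasaki2020]; M. C. Gutzwiller, Phys. Rev. Lett. 10 (1963) 159 (the correlator `Π(1 − (1−g)n↑n↓)`, here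
linearised) [Gutzwiller1963]; V. Bach, E. H. Lieb, J. P. Solovej, J. Stat. Phys. 76 (1994) 3, §2 [BachLiebSolovej1994].
-/

noncomputable section

namespace Summit.Ventures.CertifiedManyBodySolver.Observables

open Matrix Literature.MathematicalPhysics.QuantumLattice
open scoped ComplexOrder

/-! ### §1 Dressed Gibbs trial states (generic finite-dimensional) -/

section Dressed

variable {n : Type*} [Fintype n] [DecidableEq n]

/-- The Gibbs functional read through the density matrix: `⟨X⟩_β = tr(ρ_β X)` with `ρ_β = Z⁻¹ e^{−βB}`. [folklore] -/
theorem gibbsState_eq_trace_densityMatrix_mul (β : ℝ) (B X : Matrix n n ℂ) :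
    gibbsState β B X = (((partitionFn β B)⁻¹ • gibbsWeight β B) * X).trace := by
  rw [Matrix.smul_mul, trace_smul, smul_eq_mul, gibbsState_apply]

/-- **Positivity of a dressed shifted Hamiltonian in the Gibbs state**: for Hermitian `A`, `B`, `K`,
`0 ≤ Re⟨K (A − E₀(A)) K⟩_{β,B}` (`K(A − E₀)K = Kᴴ(A − E₀)K ⪰ 0` and `ρ_β ⪰ 0`). [cite: Tasaki2020, §2.1] -/
theorem re_gibbsState_conj_sub_groundEnergy_nonneg (β : ℝ) {A B K : Matrix n n ℂ} (hA : A.IsHermitian)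
    (hB : B.IsHermitian) (hK : K.IsHermitian) [Nonempty n] :
    0 ≤ (gibbsState β B (K * (A - algebraMap ℝ (Matrix n n ℂ) A.groundEnergy) * K)).re := by
  have hP : (K * (A - algebraMap ℝ (Matrix n n ℂ) A.groundEnergy) * K).PosSemidef := by
    have h := (posSemidef_sub_groundEnergy hA).conjTranspose_mul_mul_same K
    rwa [hK.eq] at h
  rw [gibbsState_eq_trace_densityMatrix_mul]
  exact Literature.LinearAlgebra.Matrix.re_trace_mul_nonneg_of_posSemidef (isDensityMatrix_gibbs β hB).1 hP

/-- **Dressed variational inequality, product form**: `E₀(A)·Re⟨KK⟩_β ≤ Re⟨KAK⟩_β` for Hermitian `A`, `B`, `K`.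
[cite: Tasaki2020, §2.1] -/
theorem groundEnergy_mul_re_gibbsState_le (β : ℝ) {A B K : Matrix n n ℂ} (hA : A.IsHermitian) (hB : B.IsHermitian)
    (hK : K.IsHermitian) [Nonempty n] :
    A.groundEnergy * (gibbsState β B (K * K)).re ≤ (gibbsState β B (K * A * K)).re := by
  have h := re_gibbsState_conj_sub_groundEnergy_nonneg β hA hB hK
  have hexp : K * (A - algebraMap ℝ (Matrix n n ℂ) A.groundEnergy) * K =
      K * A * K - (A.groundEnergy : ℂ) • (K * K) := by
    rw [Algebra.algebraMap_eq_smul_one, Matrix.mul_sub, Matrix.sub_mul, Matrix.mul_smul, Matrix.smul_mul,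
      Matrix.mul_one, ← Complex.coe_smul]
  rw [hexp, map_sub, map_smul, Complex.sub_re, smul_eq_mul, Complex.re_ofReal_mul] at h
  linarith

/-- **Dressed variational cap** (`σ = Kρ_βK/tr(ρ_βK²)` is a density matrix): if `0 < Re⟨KK⟩_β` then
`E₀(A) ≤ Re⟨KAK⟩_β / Re⟨KK⟩_β`. With `K = 1` this is `groundEnergy_le_re_gibbsState`. [cite: Tasaki2020, §2.1] -/
theorem groundEnergy_le_re_gibbsState_dressed (β : ℝ) {A B K : Matrix n n ℂ} (hA : A.IsHermitian)
    (hB : B.IsHermitian) (hK : K.IsHermitian) [Nonempty n] (ht : 0 < (gibbsState β B (K * K)).re) :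
    A.groundEnergy ≤ (gibbsState β B (K * A * K)).re / (gibbsState β B (K * K)).re := by
  rw [le_div_iff₀ ht]
  exact groundEnergy_mul_re_gibbsState_le β hA hB hK

/-- `0 ≤ Re⟨W W⟩_β` for Hermitian `W` (`WW = WᴴW ⪰ 0`). [folklore] -/
theorem re_gibbsState_mul_self_nonneg (β : ℝ) {B W : Matrix n n ℂ} (hB : B.IsHermitian) (hW : W.IsHermitian)
    [Nonempty n] : 0 ≤ (gibbsState β B (W * W)).re := by
  have hP : (W * W).PosSemidef := by
    have h := Matrix.posSemidef_conjTranspose_mul_self W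
    rwa [hW.eq] at h
  rw [gibbsState_eq_trace_densityMatrix_mul]
  exact Literature.LinearAlgebra.Matrix.re_trace_mul_nonneg_of_posSemidef (isDensityMatrix_gibbs β hB).1 hP

/-- **Centred dressing is never degenerate**: if `Re⟨W⟩_β = 0` then `1 ≤ Re⟨(1 + W)(1 + W)⟩_β`. [folklore] -/
theorem one_le_re_gibbsState_one_add_sq (β : ℝ) {B W : Matrix n n ℂ} (hB : B.IsHermitian) (hW : W.IsHermitian)
    [Nonempty n] (h0 : (gibbsState β B W).re = 0) :
    1 ≤ (gibbsState β B ((1 + W) * (1 + W))).re := by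
  have hZ : partitionFn β B ≠ 0 := (partitionFn_pos β hB).ne'
  have hexp : (1 + W) * (1 + W) = (1 : Matrix n n ℂ) + (2 : ℂ) • W + W * W := by
    simp only [Matrix.add_mul, Matrix.mul_add, Matrix.one_mul, Matrix.mul_one, two_smul]; abel
  rw [hexp, map_add, map_add, map_smul, gibbsState_one β B hZ, Complex.add_re, Complex.add_re, smul_eq_mul,
    Complex.mul_re, h0]
  norm_num
  exact re_gibbsState_mul_self_nonneg β hB hW

/-- **Dressed variational cap, centred form** (hypothesis-free denominator): for Hermitian `A`, `B`, `W` with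
`Re⟨W⟩_β = 0`, `E₀(A) ≤ Re⟨(1+W)A(1+W)⟩_β / Re⟨(1+W)(1+W)⟩_β`. [cite: Tasaki2020, §2.1] -/
theorem groundEnergy_le_re_gibbsState_dressed_centred (β : ℝ) {A B W : Matrix n n ℂ} (hA : A.IsHermitian)
    (hB : B.IsHermitian) (hW : W.IsHermitian) [Nonempty n] (h0 : (gibbsState β B W).re = 0) :
    A.groundEnergy ≤
      (gibbsState β B ((1 + W) * A * (1 + W))).re / (gibbsState β B ((1 + W) * (1 + W))).re :=
  groundEnergy_le_re_gibbsState_dressed β hA hB (Matrix.isHermitian_one.add hW)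
    (lt_of_lt_of_le zero_lt_one (one_le_re_gibbsState_one_add_sq β hB hW h0))

/-- Ring bookkeeping: `(1 + λW) A (1 + λW) = A + λ(WA + AW) + λ²(WAW)`. [folklore] -/
theorem conj_one_add_smul_expand (A W : Matrix n n ℂ) (c : ℂ) :
    (1 + c • W) * A * (1 + c • W) = A + c • (W * A + A * W) + (c ^ 2) • (W * A * W) := by
  simp only [Matrix.add_mul, Matrix.mul_add, Matrix.one_mul, Matrix.mul_one, Matrix.smul_mul, Matrix.mul_smul,
    smul_smul, smul_add, sq, Matrix.mul_assoc]
  abel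

/-- Numerator of the dressed quotient for `K = 1 + λW` (real `λ`):
`Re⟨KAK⟩ = Re⟨A⟩ + λ(Re⟨WA⟩ + Re⟨AW⟩) + λ² Re⟨WAW⟩`. [folklore] -/
theorem gibbsState_dressed_num (β : ℝ) (B A W : Matrix n n ℂ) (l : ℝ) :
    (gibbsState β B ((1 + (l : ℂ) • W) * A * (1 + (l : ℂ) • W))).re =
      (gibbsState β B A).re + l * ((gibbsState β B (W * A)).re + (gibbsState β B (A * W)).re) +
        l ^ 2 * (gibbsState β B (W * A * W)).re := by
  rw [conj_one_add_smul_expand, map_add, map_add, map_smul, map_smul, map_add, Complex.add_re, Complex.add_re,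
    smul_eq_mul, smul_eq_mul, Complex.re_ofReal_mul, Complex.add_re, ← Complex.ofReal_pow, Complex.re_ofReal_mul]

/-- Denominator of the dressed quotient for `K = 1 + λW`: `Re⟨KK⟩ = 1 + 2λ Re⟨W⟩ + λ² Re⟨WW⟩` (`Z ≠ 0`). [folklore] -/
theorem gibbsState_dressed_den (β : ℝ) {B : Matrix n n ℂ} (hB : B.IsHermitian) [Nonempty n] (W : Matrix n n ℂ)
    (l : ℝ) :
    (gibbsState β B ((1 + (l : ℂ) • W) * (1 + (l : ℂ) • W))).re =
      1 + 2 * l * (gibbsState β B W).re + l ^ 2 * (gibbsState β B (W * W)).re := by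
  have hZ : partitionFn β B ≠ 0 := (partitionFn_pos β hB).ne'
  have h := gibbsState_dressed_num β B 1 W l
  rw [Matrix.mul_one] at h
  rw [h, Matrix.mul_one, Matrix.one_mul, gibbsState_one β B hZ, Complex.one_re]
  ring

/-- **Dressed cap in certificate shape.** For Hermitian `A`, `B`, `W` and a real `λ`, if certified reals satisfy
`Re⟨A⟩ ≤ a`, `Re⟨WA⟩ + Re⟨AW⟩ = b`, `Re⟨WAW⟩ ≤ c`, `Re⟨W⟩ = d`, `Re⟨WW⟩ = e` (in the Gibbs state of `B`) and
`0 < 1 + 2λd + λ²e`, then `E₀(A) ≤ (a + λb + λ²c)/(1 + 2λd + λ²e)`. (Equalities for `b`, `d`, `e` because their signs in the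
quotient are not fixed; caps suffice for `a`, `c`.) [cite: Tasaki2020, §2.1] [cite: Gutzwiller1963, eq. (1)] -/
theorem groundEnergy_le_dressed_ratio (β : ℝ) {A B W : Matrix n n ℂ} (hA : A.IsHermitian) (hB : B.IsHermitian)
    (hW : W.IsHermitian) [Nonempty n] (l : ℝ) {a b c d e : ℝ}
    (ha : (gibbsState β B A).re ≤ a) (hb : (gibbsState β B (W * A)).re + (gibbsState β B (A * W)).re = b)
    (hc : (gibbsState β B (W * A * W)).re ≤ c) (hd : (gibbsState β B W).re = d)
    (he : (gibbsState β B (W * W)).re = e) (hpos : 0 < 1 + 2 * l * d + l ^ 2 * e) :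
    A.groundEnergy ≤ (a + l * b + l ^ 2 * c) / (1 + 2 * l * d + l ^ 2 * e) := by
  have hK : ((1 : Matrix n n ℂ) + (l : ℂ) • W).IsHermitian := by
    refine Matrix.isHermitian_one.add ?_
    unfold Matrix.IsHermitian
    rw [conjTranspose_smul, hW.eq, Complex.star_def, Complex.conj_ofReal]
  have hden := gibbsState_dressed_den β hB W l
  have hnum := gibbsState_dressed_num β B A W l
  have ht : 0 < (gibbsState β B ((1 + (l : ℂ) • W) * (1 + (l : ℂ) • W))).re := by rw [hden, hd, he]; exact hpos
  have h := groundEnergy_le_re_gibbsState_dressed β hA hB hK ht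
  rw [hnum, hden, hb, hd, he] at h
  refine h.trans (div_le_div_of_nonneg_right ?_ hpos.le)
  nlinarith [sq_nonneg l]

end Dressed

end Summit.Ventures.CertifiedManyBodySolver.Observables

end
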